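import Summits.FinalStateConjecture.FinalStateConjecture.Statement
import HarnessLib.Audit.Tags

/-!
# SoloInformed — a necessary conjunct of the final state conjecture: tame weak cosmic censorship

Soloist `solo-FinalStateConjecture-informed` (2026-08-18). Two kernel facts about the QUANTIFIER SHAPE of
the summit `FinalStateConjecture` (no geometry is used):

* `isTameChristodoulouGeneric_mono`: tame Christodoulou genericity
  (`InitialDataSet.IsTameChristodoulouGeneric`, one fixed end, immersed witness families) is monotone in the
  property — a witness family for `P` through an exceptional datum of a weaker property `Q` is a witness
  family for `Q`. (The converse direction, genericity of a conjunction from the genericities of the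
  conjuncts, is FALSE in general: the witness curves need not agree; see the soloist's PLAN.md §A2.)
* `tameWeakCosmicCensorship_of_finalStateConjecture`: the summit implies `TameWeakCosmicCensorship`, the
  weak cosmic censorship conjecture in exactly the summit's typing (tame genericity in
  `admissibleVacuumData X`; MGHD existence over the repaired `VacuumCauchyDevelopment`; complete `𝓘⁺` in
  Christodoulou's sojourn form `Summit.FinalStateConjecture.HasCompleteNullInfinity`). This records formally
  that any proof of the summit must in particular prove large-data completeness of future null infinity
  for tame-generic data (Christodoulou, CQG 16 (1999) A23, p. A27; Dafermos–Luk, arXiv:1710.01722, §1.1.1).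

References: [Christodoulou1999] p. A24, A27; [DafermosLuk2017] §1.1.1, §1.2.1.
-/

open Literature.Geometry.Lorentzian
open scoped Manifold ContDiff

namespace Summit.FinalStateConjecture.FinalStateConjecture.Theorems

/-- **Monotonicity of tame Christodoulou genericity in the property.** If `P d → Q d` for all admissible
`d` and `P` is tame-Christodoulou-generic with codimension `m` in `𝓓`, then so is `Q`: through an
exceptional datum of `Q` (which is exceptional for `P`) the `P`-witness family serves, since its members
with `c ≠ 0` satisfy `P`, hence `Q`. [cite: Christodoulou1999, p. A24] -/
theorem isTameChristodoulouGeneric_mono {X : Type*} [TopologicalSpace X] [ChartedSpace E3 X]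
    [IsManifold (𝓡 3) ∞ X] {𝓓 : Set (InitialDataSet (𝓡 3) X)}
    {P Q : InitialDataSet (𝓡 3) X → Prop} {m : ℕ} (hPQ : ∀ d ∈ 𝓓, P d → Q d)
    (h : InitialDataSet.IsTameChristodoulouGeneric 𝓓 P m) :
    InitialDataSet.IsTameChristodoulouGeneric 𝓓 Q m := by
  intro d hd
  have hd' : d ∈ 𝓓 ∧ ¬ P d := ⟨hd.1, fun hP ↦ hd.2 (hPQ d hd.1 hP)⟩
  obtain ⟨e, F, hF, himm, h0, hinj, hD, hE⟩ := h d hd'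
  refine ⟨e, F, hF, himm, h0, hinj, hD, fun c hc hmem ↦ ?_⟩
  have hmem' : F c ∈ 𝓓 ∧ ¬ Q (F c) := hmem
  exact hE c hc (show F c ∈ 𝓓 ∧ ¬ P (F c) from ⟨hmem'.1, fun hP ↦ hmem'.2 (hPQ _ hmem'.1 hP)⟩)

/-- **Tame weak cosmic censorship** (vacuum, `Λ = 0`) in the summit's typing: for every connected
Hausdorff second-countable smooth `3`-manifold `X`, tame-Christodoulou-generically (codimension `1`, one
fixed asymptotically flat end) in `admissibleVacuumData X`, the datum has a maximal globally hyperbolic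
vacuum development and every MGHD has complete future null infinity in Christodoulou's intrinsic
(sojourn) sense. Christodoulou, CQG 16 (1999) A23, p. A27; Dafermos–Luk arXiv:1710.01722 §1.1.1 ("the
modern formulation of what is known as weak cosmic censorship"). Open. [cite: Christodoulou1999, p. A27]
[cite: DafermosLuk2017, §1.1.1] -/
@[conjecture]
def TameWeakCosmicCensorship : Prop :=
  ∀ (X : Type) [TopologicalSpace X] [ChartedSpace E3 X] [IsManifold (𝓡 3) ∞ X] [T2Space X]
    [SecondCountableTopology X] [ConnectedSpace X],
    InitialDataSet.IsTameChristodoulouGeneric (admissibleVacuumData X)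
      (fun D ↦ (∃ 𝒟 : VacuumCauchyDevelopment D, 𝒟.IsMaximal) ∧
        ∀ 𝒟 : VacuumCauchyDevelopment D, 𝒟.IsMaximal →
          Summit.FinalStateConjecture.HasCompleteNullInfinity 𝒟.toCauchyDevelopment) 1

/-- **The final state conjecture implies tame weak cosmic censorship** (drop the settling clause inside
the generic property; monotonicity `isTameChristodoulouGeneric_mono`). Dafermos–Luk arXiv:1710.01722,
§1.2.1 p. 8 (the final state conjecture as the "more ambitious" statement containing completeness of
`𝓘⁺`). [cite: DafermosLuk2017, §1.2.1] -/
theorem tameWeakCosmicCensorship_of_finalStateConjecture (h : FinalStateConjecture) :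
    TameWeakCosmicCensorship := by
  intro X _ _ _ _ _ _
  exact isTameChristodoulouGeneric_mono
    (fun D _ hP ↦ ⟨hP.1, fun 𝒟 h𝒟 ↦ (hP.2 𝒟 h𝒟).1⟩) (h X)

end Summit.FinalStateConjecture.FinalStateConjecture.Theorems
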